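import Mathlib
import Literature.NumberTheory.MahlerMeasure.MinimalMeasuresByDegree
import Literature.NumberTheory.MahlerMeasure.NonreciprocalBound
import Summits.Ventures.DiscreteObjects.Mahler.SmallMeasureCensus
import Summits.Ventures.DiscreteObjects.Mahler.LehmerLowerBound
import Summits.Ventures.DiscreteObjects.Mahler.LehmerExactMeasure

/-!
# Sub-Lehmer polynomials at degree 56: structure forced by the published floor (venture `DiscreteObjects`, target L, family L6)

Cell `pub-namedobj`, seat `pub-namedobj-mahler` (gen 4). Framing: lottery ticket; floor = certified
bounds/negative ranges.

Mossinghoff–Rhin–Wu (2008), Theorem 1.1 — typed in the tree as the named fact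
`Literature.NumberTheory.MahlerMeasure.SubLehmerDegreeBound` — says that an integer polynomial with
Mahler measure in `(1, λ₀)`, `λ₀ = M(x¹⁰+x⁹-x⁷-x⁶-x⁵-x⁴-x³+x+1)`, has degree at least `56`.  Degree `56` is
therefore the first degree at which a "Lehmer ticket" can exist, and this file proves (kernel-checked,
CONDITIONAL on that named fact only) what such a polynomial `P` of degree EXACTLY `56` must look like:

* `natDegree_eq_zero_of_dvd_of_measure_one` — every factor of `P` of Mahler measure `1` is constant;
* `not_cyclotomic_dvd`, `not_X_dvd` — `P` has no cyclotomic factor and `x ∤ P`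
  (Mathlib: `Polynomial.cyclotomic_mahlerMeasure_eq_one`);
* `irreducible_of_subLehmer` — `P` is irreducible;
* `reciprocal_of_subLehmer` — `P` is reciprocal or antireciprocal, CONDITIONAL in addition on Smyth's
  theorem (named fact `Literature.NumberTheory.MahlerMeasure.NonreciprocalMahlerBound`), using the
  kernel bounds `M(x³-x-1) > 1.32` (real root, intermediate value theorem) and `M(L) < 1.17629`
  (`lehmer_measure_upper_bound`).

These are exactly the hypotheses of the cell's CORES-mode census (cyclotomic-free polynomials with root
set closed under `z ↦ 1/z̄`, pruned by certified auxiliary-function bounds on power sums), so the census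
statement of family L6, `Height1Degree56SubLehmerEmpty` (= `HeightBoundedCensus 56 1 (M L) []`: no
integer polynomial of degree `56` with coefficients in `{-1,0,1}` has measure in `(1, λ₀)`), is decided by
that census.  The statement is TYPED here; its certificate is the cell's two-engine enumeration
(EFFICIENCY-L6.md), not a Lean proof.
-/

namespace Summit.Ventures.DiscreteObjects.Mahler

open Polynomial Literature.NumberTheory.MahlerMeasure

/-- `P` is *sub-Lehmer*: `1 < M(P) < M(L)` with `L` Lehmer's polynomial. -/
def SubLehmer (P : ℤ[X]) : Prop :=
  1 < intMahlerMeasure P ∧ intMahlerMeasure P < intMahlerMeasure lehmerPoly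

/-- **Family L6 census statement (typed, not proved):** no integer polynomial of degree `56` and height
`≤ 1` (coefficients in `{-1, 0, 1}`) has Mahler measure in `(1, M(L))` — the height-bounded census row
`(n, h, B) = (56, 1, M(L))` with the EMPTY witness list. -/
def Height1Degree56SubLehmerEmpty : Prop :=
  HeightBoundedCensus 56 1 (intMahlerMeasure lehmerPoly) []

/-- With an empty witness list a height-bounded census row says exactly that the region is empty. -/
theorem heightBoundedCensus_nil_iff (n h : ℕ) (B : ℝ) :
    HeightBoundedCensus n h B [] ↔
      ∀ p : ℤ[X], p.natDegree = n → height p ≤ h → 1 < intMahlerMeasure p → ¬ intMahlerMeasure p < B := by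
  simp [HeightBoundedCensus]

/-- Unfolded form of the L6 statement. -/
theorem height1Degree56SubLehmerEmpty_iff :
    Height1Degree56SubLehmerEmpty ↔ ∀ p : ℤ[X], p.natDegree = 56 → height p ≤ 1 → ¬ SubLehmer p := by
  unfold Height1Degree56SubLehmerEmpty SubLehmer
  rw [heightBoundedCensus_nil_iff]
  exact forall_congr' fun p => by tauto

/-- The Literature file's Lehmer polynomial is the cell's `lehmerPoly` (same expression). -/
theorem lehmerPolynomial_eq_lehmerPoly : lehmerPolynomial = lehmerPoly := rfl

/-- The published floor in the cell's vocabulary: a sub-Lehmer integer polynomial has degree `≥ 56`. -/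
theorem natDegree_ge_of_subLehmer (h : SubLehmerDegreeBound) {P : ℤ[X]} (hP : SubLehmer P) :
    56 ≤ P.natDegree :=
  h P hP.1 hP.2

/-- Multiplicativity of the integer Mahler measure (from Mathlib's `mahlerMeasure_mul`). -/
theorem intMahlerMeasure_mul (p q : ℤ[X]) :
    intMahlerMeasure (p * q) = intMahlerMeasure p * intMahlerMeasure q := by
  unfold intMahlerMeasure
  rw [Polynomial.map_mul, mahlerMeasure_mul]

/-- A nonzero integer polynomial has Mahler measure `≥ 1` (Mathlib). -/
theorem one_le_intMahlerMeasure {p : ℤ[X]} (hp : p ≠ 0) : 1 ≤ intMahlerMeasure p :=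
  one_le_mahlerMeasure_of_ne_zero hp

/-- The Mahler measure of an integer constant is its absolute value. -/
theorem intMahlerMeasure_C (c : ℤ) : intMahlerMeasure (C c) = |(c : ℝ)| := by
  unfold intMahlerMeasure
  rw [Polynomial.map_C, mahlerMeasure_const]
  simp

/-- The Mahler measure of `x` is `1`. -/
theorem intMahlerMeasure_X : intMahlerMeasure (X : ℤ[X]) = 1 := by
  unfold intMahlerMeasure
  rw [Polynomial.map_X]
  have hX : (X : ℂ[X]) = X - C 0 := by simp
  rw [hX, mahlerMeasure_X_sub_C]
  simp

/-- The Mahler measure of a cyclotomic polynomial is `1` (Mathlib, in the cell's vocabulary). -/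
theorem intMahlerMeasure_cyclotomic (n : ℕ) : intMahlerMeasure (cyclotomic n ℤ) = 1 := by
  unfold intMahlerMeasure
  rw [← algebraMap_int_eq]
  exact cyclotomic_mahlerMeasure_eq_one n

/-- **Main reduction.** In a sub-Lehmer integer polynomial of degree exactly `56`, every factor of
Mahler measure `1` is a constant: otherwise the cofactor would be a sub-Lehmer polynomial of degree
`< 56`, contradicting [MRW08, Thm 1.1]. -/
theorem natDegree_eq_zero_of_dvd_of_measure_one (h : SubLehmerDegreeBound) {P R : ℤ[X]}
    (hdeg : P.natDegree = 56) (hP : SubLehmer P) (hR : R ∣ P) (hMR : intMahlerMeasure R = 1) :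
    R.natDegree = 0 := by
  obtain ⟨Q, rfl⟩ := hR
  have hP0 : R * Q ≠ 0 := by
    intro h0
    rw [h0, natDegree_zero] at hdeg
    exact absurd hdeg (by norm_num)
  have hR0 : R ≠ 0 := left_ne_zero_of_mul hP0
  have hQ0 : Q ≠ 0 := right_ne_zero_of_mul hP0
  have hMQ : intMahlerMeasure Q = intMahlerMeasure (R * Q) := by
    rw [intMahlerMeasure_mul, hMR, one_mul]
  have hQsub : SubLehmer Q := by
    unfold SubLehmer at hP ⊢
    rw [hMQ]
    exact hP
  have hQdeg : 56 ≤ Q.natDegree := natDegree_ge_of_subLehmer h hQsub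
  rw [natDegree_mul hR0 hQ0] at hdeg
  omega

/-- A sub-Lehmer integer polynomial of degree `56` has no cyclotomic factor. -/
theorem not_cyclotomic_dvd (h : SubLehmerDegreeBound) {P : ℤ[X]} (hdeg : P.natDegree = 56)
    (hP : SubLehmer P) {n : ℕ} (hn : 0 < n) : ¬ cyclotomic n ℤ ∣ P := by
  intro hdvd
  have h0 := natDegree_eq_zero_of_dvd_of_measure_one h hdeg hP hdvd (intMahlerMeasure_cyclotomic n)
  rw [natDegree_cyclotomic] at h0
  have := Nat.totient_pos.mpr hn
  omega

/-- A sub-Lehmer integer polynomial of degree `56` is not divisible by `x`. -/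
theorem not_X_dvd (h : SubLehmerDegreeBound) {P : ℤ[X]} (hdeg : P.natDegree = 56) (hP : SubLehmer P) :
    ¬ X ∣ P := by
  intro hdvd
  have h0 := natDegree_eq_zero_of_dvd_of_measure_one h hdeg hP hdvd intMahlerMeasure_X
  rw [natDegree_X] at h0
  exact absurd h0 (by norm_num)

/-- Equivalently: its constant coefficient is nonzero. -/
theorem coeff_zero_ne_zero (h : SubLehmerDegreeBound) {P : ℤ[X]} (hdeg : P.natDegree = 56)
    (hP : SubLehmer P) : P.coeff 0 ≠ 0 := by
  intro h0
  exact not_X_dvd h hdeg hP (X_dvd_iff.mpr h0)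

/-- A sub-Lehmer integer polynomial of degree `56` is irreducible in `ℤ[x]`: a constant factor `c` has
`|c| = M(c) ≤ M(P) < 2`, and two non-constant factors would both have degree `< 56`, hence measure `= 1`
(impossible by the main reduction) or `≥ M(L)`, forcing `M(P) ≥ M(L)`. -/
theorem irreducible_of_subLehmer (h : SubLehmerDegreeBound) {P : ℤ[X]} (hdeg : P.natDegree = 56)
    (hP : SubLehmer P) : Irreducible P := by
  have hP0 : P ≠ 0 := by
    intro h0; rw [h0, natDegree_zero] at hdeg; exact absurd hdeg (by norm_num)
  have hLup : intMahlerMeasure lehmerPoly < 117629 / 100000 := lehmer_measure_upper_bound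
  rw [irreducible_iff]
  refine ⟨fun hu => ?_, fun a b hab => ?_⟩
  · have := natDegree_eq_zero_of_isUnit hu
    omega
  · have ha0 : a ≠ 0 := by intro h0; apply hP0; rw [hab, h0, zero_mul]
    have hb0 : b ≠ 0 := by intro h0; apply hP0; rw [hab, h0, mul_zero]
    have hMab : intMahlerMeasure P = intMahlerMeasure a * intMahlerMeasure b := by
      rw [hab, intMahlerMeasure_mul]
    have ha1 : 1 ≤ intMahlerMeasure a := one_le_intMahlerMeasure ha0
    have hb1 : 1 ≤ intMahlerMeasure b := one_le_intMahlerMeasure hb0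
    have hdegab : a.natDegree + b.natDegree = 56 := by rw [← natDegree_mul ha0 hb0, ← hab, hdeg]
    -- a factor of degree 0 is a constant of absolute value 1, hence a unit
    have hconst : ∀ {c d : ℤ[X]}, P = c * d → c ≠ 0 → d ≠ 0 → c.natDegree = 0 → IsUnit c := by
      intro c d hcd hc0 hd0 hc
      rw [eq_C_of_natDegree_eq_zero hc]
      rw [eq_C_of_natDegree_eq_zero hc] at hcd
      apply isUnit_C.mpr
      rw [Int.isUnit_iff_abs_eq]
      have hMc : intMahlerMeasure P = |((c.coeff 0 : ℤ) : ℝ)| * intMahlerMeasure d := by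
        rw [hcd, intMahlerMeasure_mul, intMahlerMeasure_C]
      have hd1 : 1 ≤ intMahlerMeasure d := one_le_intMahlerMeasure hd0
      have hcne : c.coeff 0 ≠ 0 := by
        intro h0; apply hc0; rw [eq_C_of_natDegree_eq_zero hc, h0, C_0]
      have hcabs1 : (1 : ℤ) ≤ |c.coeff 0| := Int.one_le_abs hcne
      have hlt2 : |((c.coeff 0 : ℤ) : ℝ)| < 2 := by
        by_contra hge
        rw [not_lt] at hge
        have : (2 : ℝ) * 1 ≤ |((c.coeff 0 : ℤ) : ℝ)| * intMahlerMeasure d :=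
          mul_le_mul hge hd1 (by norm_num) (by positivity)
        linarith [hP.2]
      have hlt2' : |c.coeff 0| < 2 := by
        have : (|c.coeff 0| : ℝ) < 2 := by simpa [Int.cast_abs] using hlt2
        exact_mod_cast this
      omega
    by_cases ha : a.natDegree = 0
    · exact Or.inl (hconst hab ha0 hb0 ha)
    by_cases hb : b.natDegree = 0
    · exact Or.inr (hconst (by rw [hab, mul_comm]) hb0 ha0 hb)
    -- both factors non-constant: each has measure ≥ M(L)
    exfalso
    have hMa : intMahlerMeasure lehmerPoly ≤ intMahlerMeasure a := by
      by_contra hlt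
      rw [not_le] at hlt
      rcases eq_or_lt_of_le ha1 with h1 | h1
      · have := natDegree_eq_zero_of_dvd_of_measure_one h hdeg hP (Dvd.intro b hab.symm) h1.symm
        exact ha this
      · have := natDegree_ge_of_subLehmer h ⟨h1, hlt⟩
        omega
    have : intMahlerMeasure lehmerPoly ≤ intMahlerMeasure P := by
      rw [hMab]
      calc intMahlerMeasure lehmerPoly = intMahlerMeasure lehmerPoly * 1 := (mul_one _).symm
        _ ≤ intMahlerMeasure a * intMahlerMeasure b :=
          mul_le_mul hMa hb1 (by norm_num) (le_trans (by norm_num) ha1)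
    linarith [hP.2]

/-- Kernel bound for Smyth's constant: `M(x³ - x - 1) > 1.32` (its real root lies in `(1.32, 1.33)`). -/
theorem smythPoly_measure_lower_bound :
    (132 : ℝ) / 100 < intMahlerMeasure (X ^ 3 - X - 1 : ℤ[X]) := by
  set f : ℝ → ℝ := fun x => x ^ 3 - x - 1 with hf
  have hcont : Continuous f := by rw [hf]; fun_prop
  have ha : f (132 / 100) < 0 := by rw [hf]; norm_num
  have hb : 0 < f (133 / 100) := by rw [hf]; norm_num
  have hab : (132 : ℝ) / 100 ≤ 133 / 100 := by norm_num
  obtain ⟨α, hαI, hαf⟩ : ∃ α ∈ Set.Ioo ((132 : ℝ) / 100) (133 / 100), f α = 0 :=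
    intermediate_value_Ioo hab hcont.continuousOn ⟨ha, hb⟩
  have hmonic : (X ^ 3 - X - 1 : ℤ[X]).Monic := by monicity!
  have hroot : aeval (α : ℂ) (X ^ 3 - X - 1 : ℤ[X]) = 0 := by
    have h0 : α ^ 3 - α - 1 = 0 := hαf
    have h1 : ((α : ℂ)) ^ 3 - (α : ℂ) - 1 = 0 := by exact_mod_cast congrArg (fun r : ℝ => (r : ℂ)) h0
    simpa [map_sub] using h1
  have hle := norm_root_le_intMahlerMeasure hmonic hroot
  have hpos : 0 ≤ α := by linarith [hαI.1]
  rw [Complex.norm_real, Real.norm_of_nonneg hpos] at hle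
  linarith [hαI.1]

/-- A sub-Lehmer integer polynomial of degree `56` is reciprocal or antireciprocal
(`P.reverse = ± P`), CONDITIONAL on Smyth's theorem (named fact) besides [MRW08, Thm 1.1]:
otherwise `1.32 < M(x³-x-1) ≤ M(P) < M(L) < 1.17629`. -/
theorem reciprocal_of_subLehmer (h : SubLehmerDegreeBound) (hS : NonreciprocalMahlerBound) {P : ℤ[X]}
    (hdeg : P.natDegree = 56) (hP : SubLehmer P) : P.reverse = P ∨ P.reverse = -P := by
  by_contra hnot
  push Not at hnot
  have hirr := irreducible_of_subLehmer h hdeg hP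
  have hc0 := coeff_zero_ne_zero h hdeg hP
  have hsm : intMahlerMeasure (X ^ 3 - X - 1 : ℤ[X]) ≤ intMahlerMeasure P := hS P hirr hc0 hnot.1 hnot.2
  have h1 := smythPoly_measure_lower_bound
  have h2 : intMahlerMeasure lehmerPoly < 117629 / 100000 := lehmer_measure_upper_bound
  linarith [hP.2]

/-- **Scope of the CORES-mode census at degree 56** (summary): conditional on [MRW08, Thm 1.1], a
sub-Lehmer integer polynomial of degree `56` is irreducible, has nonzero constant term and no cyclotomic
factor — so it lies in the family the cell's census enumerates completely (EFFICIENCY-L6.md). -/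
theorem cores_scope_of_subLehmer (h : SubLehmerDegreeBound) {P : ℤ[X]} (hdeg : P.natDegree = 56)
    (hP : SubLehmer P) :
    Irreducible P ∧ P.coeff 0 ≠ 0 ∧ ∀ n : ℕ, 0 < n → ¬ cyclotomic n ℤ ∣ P :=
  ⟨irreducible_of_subLehmer h hdeg hP, coeff_zero_ne_zero h hdeg hP, fun _ hn => not_cyclotomic_dvd h hdeg hP hn⟩

/-- **What the CORES-mode census of family L6 certifies** (typed): no CYCLOTOMIC-FREE integer polynomial of
degree `56` and height `≤ 1` is sub-Lehmer.  (The enumeration is complete exactly for cyclotomic-free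
reciprocal-closed polynomials — the hypothesis of the auxiliary-function boxes; EFFICIENCY-L6.md.) -/
def CyclotomicFreeHeight1Degree56SubLehmerEmpty : Prop :=
  ∀ P : ℤ[X], P.natDegree = 56 → height P ≤ 1 → (∀ n : ℕ, 0 < n → ¬ cyclotomic n ℤ ∣ P) → ¬ SubLehmer P

/-- **Assembly of the L6 bound line (kernel):** the published floor [MRW08, Thm 1.1] (named fact) and the
census certificate for cyclotomic-free polynomials together give the headline statement
`Height1Degree56SubLehmerEmpty` — because a sub-Lehmer polynomial of degree `56` is automatically
cyclotomic-free (`not_cyclotomic_dvd`). -/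
theorem height1Degree56SubLehmerEmpty_of_cores (h : SubLehmerDegreeBound)
    (hcensus : CyclotomicFreeHeight1Degree56SubLehmerEmpty) : Height1Degree56SubLehmerEmpty := by
  rw [height1Degree56SubLehmerEmpty_iff]
  intro p hdeg hh hsub
  exact hcensus p hdeg hh (fun n hn => not_cyclotomic_dvd h hdeg hsub hn) hsub

end Summit.Ventures.DiscreteObjects.Mahler
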